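import Summits.QuantumFields.BalabanUV.Beta.D1BFx.CoframeJetDipoleLetters
import Summits.QuantumFields.BalabanUV.Beta.D1BFx.ProjectorGradientMass

/-!
# `BalabanUV.Beta.D1BFx.CoframeJetMassScales` — road «BF-x» for BINDER row D1, slot (K): **THE (C1) ROW «TB4-W CO-FRAME FIRST JET,
# m-UNIFORM MASS» ON THE SCALES `n = L^k` AS A THEOREM** (part 5 of «COFRAME-JET-DIPOLE»: β2's ghost-leg masses + parts 3∕4)

HONEST DEPENDENCY (page 1, mandatory): continuum YM on T⁴ ⇐ BetaPertH ∧ nine spine estimates (0/9 proved); BetaPertH ⇐ (D1) ∧ (D4) ∧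
CAP+tail; G-an2-4 gates asym, D1 and NE2/3/4.  HONEST FRAMING (cell contract, verbatim): «discharging `BetaPertH` makes Bałaban's UV
stability UNCONDITIONAL — a real constructive-QFT result; it is NOT the continuum limit and NOT the Clay problem.»  THIS FILE DISCHARGES
NOTHING of D1 / BetaPertH and closes NO binder of the spine root: it proves the two DISPLAYED (C1) hypotheses `hTs ∕ hTm` of the road's
END `RoadEndBFxRoadScalesS.d1Rep_BFx_road_scales_sbpS` (OWNER d1-p2 g19, p331212) — the weighted `ℓ¹(ℤ⁴×ℤ⁴)` mass of the twisted
co-frame first-jet bond kernel `tBw₁ (L^k) a κ u` at rate `σV∕L^k` about the bond base `u` — for every `σV` in an explicit window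
`0 ≤ σV ≤ σ₀(L,a)` with a k-FREE constant `mT(σV)`; the END's other window clauses on `σV` (`hσVκ`, `hσVS`) are untouched and the
assembler still chooses `σV`.  The analytic input is gan24-leaf-05's kernel-checked ghost-leg profile (β2 `GhostLegProfile.exists_Ggh_masses`,
itself [folklore] lattice potential theory over lit-balaban's `B3GkZeroLattice`); everything else is [folklore] `ℓ¹` bookkeeping over
the road's OWN objects (parts 1–4, γ1∕γ2).  (C2) untouched; the junctions (J1)(J2)(J3) untouched; (K) NOT closed; 0∕4 row-D1 binders
discharged; NOT D1, NOT BetaPertH, NOT continuum, NOT Clay.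

WHAT IS HERE (unit `b2b-balaban-beta-d1-formalise-leaf-03`, gen 25):
* §1 bridges from β2's explicit letters (`Unit` fibre, `B6QGQLower276.e μ = AffineAveraging.unitVec μ` definitionally) to `RowMass ∕ ColMass`.
* §2 **`exists_C1_letters (hL : 2 ≤ L) (ha : 0 < a) : ∃ σ₀ > 0, ∀ σV, 0 ≤ σV → σV ≤ σ₀ → ∃ mT, ∀ k ≥ 1, ∀ κ u,
  (Summable fun p ↦ Σ g, Σ f, |tBw₁ (L^k) a κ u p.1 p.2 g f|·e^{(σV∕↑(L^k))(|p.1−u|₁+|p.2−u|₁)}) ∧ Σ' … ≤ mT`** — `σ₀ = min (δ∕8) (δ_C∕8)`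
  (β2's rate `δ`, the operator-`C` rate `δ_C = deltaC 4 a`), `mT = 16·e^{σV}·(8·P·(g₁ + P·g₀) + (1 + e^{σV} + P))`,
  `P = e^{8σV}·g₁·g₀·c_C·Zl 4 (δ_C∕4 − σV)`: the `n²` of the legs is cancelled by the two `1∕n` of `g₁∕n` (β2) and `p₁ = P∕n` (part 4).

No `def`, no `def … : Prop`, nothing cited as mathematics.
-/

noncomputable section

namespace Summit.QuantumFields.BalabanUV.Beta.D1BFx.CoframeJetMassScales

open scoped BigOperators
open Literature.MathematicalPhysics.QuantumFieldTheory.Balaban1983to89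
open Literature.MathematicalPhysics.QuantumFieldTheory.Balaban1983to89.Beta
open B12Sec2to5 (l1 l1_nonneg)
open ExpKernelCalculus (Site MKer Zl Zl_pos)
open AffineAveraging (unitVec)
open B6QGGQ278Zd (cC deltaC cC_pos deltaC_pos)
open Summit.QuantumFields.BalabanUV.Beta.TameKernelCalculus (trK)
open Summit.QuantumFields.BalabanUV.Beta.D1BFx.GhostLeg (Ggh trK_Ggh)
open Summit.QuantumFields.BalabanUV.Beta.D1BFx.RProjector (Pgt)
open Summit.QuantumFields.BalabanUV.Beta.D1BFx.TorusWeightWordTwisted (tBw₁)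
open Summit.QuantumFields.BalabanUV.Beta.D1BFx.KernelMassCalculus (rowFn RowMass ColMass colMass_iff_rowMass_trK)
open Summit.QuantumFields.BalabanUV.Beta.D1BFx.GhostLegMasses (rowFn_unit)
open Summit.QuantumFields.BalabanUV.Beta.D1BFx.GhostLegProfile (exists_Ggh_masses)
open Summit.QuantumFields.BalabanUV.Beta.D1BFx.CoframeJetDipoleLetters (tBw₁_weighted_mass_le_of_leg_letters)
open Summit.QuantumFields.BalabanUV.Beta.D1BFx.ProjectorGradientMass (colMass_rowGrad_Pgt)

/-! ## §1 Bridges: explicit `Unit`-fibre letters to `RowMass ∕ ColMass` -/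

/-- [folklore] A row letter in explicit form IS `RowMass` on a `Unit` fibre. -/
theorem rowMass_of_explicit {K : MKer 4 Unit} {θ M : ℝ}
    (h : ∀ x : Site 4, (Summable fun y : Site 4 => |K x y () ()| * Real.exp (θ * l1 (x - y))) ∧
      ∑' y : Site 4, |K x y () ()| * Real.exp (θ * l1 (x - y)) ≤ M) : RowMass K θ M := by
  intro x
  have e : rowFn K θ x = fun y => |K x y () ()| * Real.exp (θ * l1 (x - y)) := funext fun y => rowFn_unit K θ x y
  rw [e]
  exact h x

/-- [folklore] A column letter in explicit form IS `ColMass` on a `Unit` fibre. -/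
theorem colMass_of_explicit {K : MKer 4 Unit} {θ M : ℝ}
    (h : ∀ y : Site 4, (Summable fun x : Site 4 => |K x y () ()| * Real.exp (θ * l1 (x - y))) ∧
      ∑' x : Site 4, |K x y () ()| * Real.exp (θ * l1 (x - y)) ≤ M) : ColMass K θ M := by
  intro y
  have e : (fun x => rowFn K θ x y) = fun x => |K x y () ()| * Real.exp (θ * l1 (x - y)) := funext fun x => rowFn_unit K θ x y
  rw [e]
  exact h y

/-! ## §2 The (C1) row on the scales -/

/-- [folklore] **THE (C1) ROW «TB4-W CO-FRAME FIRST JET, m-UNIFORM MASS» ON THE SCALES, AS A THEOREM.**  For `L ≥ 2`, `a > 0` there is a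
window `σ₀ > 0` such that for every rate `0 ≤ σV ≤ σ₀` ONE constant `mT` bounds, for every `k ≥ 1` and every fine bond `(κ, u)`, the
`u`-centred weighted `ℓ¹(ℤ⁴ × ℤ⁴)` mass of the twisted co-frame first-jet bond kernel `tBw₁ (L^k) a κ u` at rate `σV∕L^k` — EXACTLY the
summands of PART 14's `hTs ∕ hTm`. -/
theorem exists_C1_letters {L : ℕ} [NeZero L] (hL : 2 ≤ L) {a : ℝ} (ha : 0 < a) :
    ∃ σ₀ : ℝ, 0 < σ₀ ∧ ∀ σV : ℝ, 0 ≤ σV → σV ≤ σ₀ → ∃ mT : ℝ, ∀ (k : ℕ), 1 ≤ k → ∀ (κ : Fin 4) (u : Fin 4 → ℤ),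
      (Summable fun p : Site 4 × Site 4 => ∑ g, ∑ f,
        |tBw₁ (L ^ k) a κ u p.1 p.2 g f| * Real.exp (σV / ((L ^ k : ℕ) : ℝ) * (l1 (p.1 - u) + l1 (p.2 - u)))) ∧
      ∑' p : Site 4 × Site 4, ∑ g, ∑ f,
        |tBw₁ (L ^ k) a κ u p.1 p.2 g f| * Real.exp (σV / ((L ^ k : ℕ) : ℝ) * (l1 (p.1 - u) + l1 (p.2 - u))) ≤ mT := by
  obtain ⟨δ, g₀, g₁, hδ, hg₀, hg₁, H⟩ := exists_Ggh_masses (L := L) (a := a) hL ha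
  have hδC := deltaC_pos 4 ha
  have hcC := (cC_pos 4 ha).le
  refine ⟨min (δ / 8) (deltaC 4 a / 8), lt_min (by linarith) (by linarith), fun σV hσ0 hσ => ?_⟩
  have hσδ : σV ≤ δ / 8 := hσ.trans (min_le_left _ _)
  have hσC : σV ≤ deltaC 4 a / 8 := hσ.trans (min_le_right _ _)
  -- the k-free constants
  set P : ℝ := Real.exp (8 * σV) * g₁ * g₀ * (cC 4 a * Zl 4 (deltaC 4 a / 4 - σV)) with hP
  have hZ : 0 ≤ Zl 4 (deltaC 4 a / 4 - σV) := (Zl_pos (by linarith)).le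
  have hP0 : 0 ≤ P := by positivity
  refine ⟨16 * Real.exp σV * (8 * (P * (g₁ + P * g₀)) + (1 + Real.exp σV + P)), fun k hk κ u => ?_⟩
  -- one scale
  set n : ℕ := L ^ k with hn
  have hn0 : (n : ℝ) ≠ 0 := by exact_mod_cast NeZero.ne n
  have hn1 : (1 : ℝ) ≤ n := by exact_mod_cast Nat.one_le_iff_ne_zero.2 (NeZero.ne n)
  have hnpos : (0 : ℝ) < n := by positivity
  set s : ℝ := σV / (n : ℝ) with hs
  have hs0 : 0 ≤ s := div_nonneg hσ0 hnpos.le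
  have hns : (n : ℝ) * s = σV := by rw [hs, mul_div_cancel₀ _ hn0]
  have hsσ : s ≤ σV := div_le_self hσ0 hn1
  have hsδ : s ≤ δ / (8 * n) := by
    rw [hs, show δ / (8 * (n : ℝ)) = δ / 8 / n by rw [div_div]]
    exact div_le_div_of_nonneg_right hσδ hnpos.le
  have hsC : (n : ℝ) * s < deltaC 4 a / 4 := by rw [hns]; linarith
  -- β2's letters at this scale and rate
  have Hk := H k hk n rfl s hsδ
  have hGr : RowMass (Ggh n a) s g₀ := rowMass_of_explicit fun x => (Hk x () ()).1
  have hGc : ColMass (Ggh n a) s g₀ := by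
    rw [colMass_iff_rowMass_trK, trK_Ggh n a ha]; exact hGr
  have hG₁ : ∀ α : Fin 4, ColMass (fun x y (v w : Unit) => Ggh n a (x + unitVec α) y v w - Ggh n a x y v w) s (g₁ / n) :=
    fun α => colMass_of_explicit fun y => ⟨((Hk y () ()).2 α).2.2.1, ((Hk y () ()).2 α).2.2.2.1⟩
  -- the projector's gradient letter (part 4), constant `= P ∕ n`
  have hP₁ : ∀ α : Fin 4, ColMass (fun x y (v w : Unit) => Pgt n a (x + unitVec α) y v w - Pgt n a x y v w) s (P / n) := by
    intro α
    have h := colMass_rowGrad_Pgt n a ha hs0 hsC α hGr hGc (hG₁ α)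
    refine h.mono le_rfl (le_of_eq ?_)
    rw [hP, show (8 : ℝ) * n * s = 8 * σV by rw [mul_assoc, hns], show (n : ℝ) * s = σV from hns]
    field_simp
  -- part 3 at this scale
  have h3 := tBw₁_weighted_mass_le_of_leg_letters n a κ u ha hs0 hGc hG₁ hP₁
  refine ⟨h3.1, h3.2.trans ?_⟩
  -- k-free majorisation of the constant
  have hes : Real.exp s ≤ Real.exp σV := Real.exp_le_exp.2 hsσ
  have hPn : P / n ≤ P := div_le_self hP0 hn1
  have hX : (n : ℝ) ^ 2 * (P / n * (g₁ / n + P / n * g₀)) = P * (g₁ + P * g₀) := by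
    field_simp
  have hX' : 8 * (n : ℝ) ^ 2 * (P / n * (g₁ / n + P / n * g₀)) = 8 * (P * (g₁ + P * g₀)) := by rw [mul_assoc, hX]
  rw [hX']
  have hA : 0 ≤ 8 * (P * (g₁ + P * g₀)) + (1 + Real.exp s + P / n) := by positivity
  calc 16 * Real.exp s * (8 * (P * (g₁ + P * g₀)) + (1 + Real.exp s + P / n))
      ≤ 16 * Real.exp σV * (8 * (P * (g₁ + P * g₀)) + (1 + Real.exp s + P / n)) :=
        mul_le_mul_of_nonneg_right (mul_le_mul_of_nonneg_left hes (by norm_num)) hA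
    _ ≤ 16 * Real.exp σV * (8 * (P * (g₁ + P * g₀)) + (1 + Real.exp σV + P)) :=
        mul_le_mul_of_nonneg_left (by linarith) (by positivity)

end Summit.QuantumFields.BalabanUV.Beta.D1BFx.CoframeJetMassScales

end
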